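import Summits.Ventures.GridStability.Models.NE39SP
import Summits.Ventures.GridStability.Lyapunov.StructurePreservingLevelBound
import Summits.Ventures.GridStability.Lyapunov.StructurePreservingRoa
import Summits.Ventures.GridStability.Lyapunov.TreePoincare
import Literature.MathematicalPhysics.PowerSystems.PowerFlowEquilibriumExistence
import HarnessLib

/-!
# GridStability/Bench/NE39SPPrintedData — rung «G2.b-SP NE39», route (b), file 1 of 2: the printed
# injections, the route-(b) instance, and the three hypotheses of the equilibrium-existence theorem

Cell `gridfusion` (LADDER-GRIDFUSION), `plan/PARTITION.md` A25 route (b) (lead 2026-08-27T01:16:41Z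
(2) / 01:37:36Z: «ONE Summits-side file … bridge exists_equilibrium_of_residual_reference → p475989»);
seat gridfusion-lyap-1 (g3); namespace `Summit.Ventures.GridStability.Bench.NE39SP`. File 1 of 2: data,
instance and the hypotheses (i)–(iii); the existence theorem and the «-roa» sentence are in
`Bench/NE39SPPrintedRoa.lean`. Route (a)
(`Bench/NE39SPEnergyRoa.lean`, p481288) DEFINED the injections as `P⁰ := f(δ₀)` at the exact
half-angle point `δ₀` (eq=b; MV-P: `max|P′ − P_printed| = 3.6·10⁻⁹` off the slack). Route (b)
keeps the PRINTED injections of [cite: Padiyar2013, App. D Table D.3] (generator `P_G`, load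
`−P_L`, node order of `Models/NE39SP.lean`) with ONE declared datum — the slack: Table D.3's
lossless load flow prints `Σ P_G − Σ P_L = 9/100000`, so `P_r := P_G1 − 9/100000 = 1009/200` at
the reference machine G1 (idx 39), token «MV-P(9e-5 @ slack)» (model-4
`bench/data/NE39/sp49/routeb-LF.json` 5658b3fb56a02842) — and PROVES that an exact synchronous
equilibrium `θ⋆` of the structure-preserving model with these injections EXISTS within `2·10⁻⁶`
rad of `δ₀` (every coordinate), by lit-1's kernel existence theorem
`ClassicalModel.exists_equilibrium_of_residual_reference` (p481514: Dvijotham–Low–Chertkov 2015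
Cor. 1 + Boyd–Vandenberghe (9.11), energy minimisation on a box, no fixed-point theorem), whose
three instance hypotheses are discharged HERE without any matrix certificate:
(i) MARGIN `|δ₀ᵢ − δ₀ⱼ| + 2R ≤ γ := 2·arctan τ′`, `τ′ = τ_max + 10⁻⁵`, from model-2's window
lemma and the elementary bound `u/(1 + u²) ≤ arctan u` (`div_one_add_sq_le_arctan`);
(ii) COERCIVITY `μ Σ vᵢ² ≤ c₀ · ½ΣΣ bᵢⱼ(vᵢ − vⱼ)²` for `v_r = 0` from this seat's TREE POINCARÉ
inequality (`Lyapunov/TreePoincare.lean`, p483703) on model-4's BFS spanning tree (parent array +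
depths already typed in `NE39SP.lean`; `Σ depth = 338`), `μ = c₀β/676`, `c₀ = cos γ =
(1 − τ′²)/(1 + τ′²)`, `β = 5200202273/312500000`;
(iii) RESIDUAL `4 Σ_{i ≠ r} (Pᵢ − fᵢ(δ₀))² < μ²R²` with `R = 2·10⁻⁶`: the 48 residuals are exact
rationals (`fᵢ(δ₀)` = `pePoly` in the half-angle rationals, re-indexed over the 56 edges,
`pe_δ₀_eq_cast`) and the inequality is ONE `decide` over `ℚ` (`4Σres² ≈ 3.08·10⁻¹⁶ < μ²R² ≈
2.05·10⁻¹⁵`).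
Then `θ⋆` is a synchronous equilibrium of `paramsB D` (`P⁰ := P_fixed`, `Σ P⁰ = 0` so `ω₀ = 0`)
for EVERY damping vector `D > 0`, every coupled pair has `|θ⋆ᵢ − θ⋆ⱼ| < γ < π/2`, and this
seat's `Lyapunov.StructurePreserving.sublevel_subset_regionOfAttraction` (p475989) at the certified
level `29/10 < c⋆(γ, β)` (`level_lt_levelBound_routeB`, π-bound of p479424) gives the sentence.

THREE COLUMNS. CERTIFIED (kernel): existence of `θ⋆` with `|θ⋆ᵢ − δ₀ᵢ| < 2·10⁻⁶`, `f(θ⋆) = P_fixed`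
exactly, `|θ⋆ᵢ − θ⋆ⱼ| < 2·arctan τ′` on lines; `29/10 < c⋆`; and (`printed_roa`) for every `D > 0`:
from every phase point of `S = {V(θ⋆; δ, ω) ≤ 29/10} ∩ window ∩ {L = L(θ⋆, 0), ω_bus = 0}` a global
solution exists and EVERY global solution stays in `S` and tends to `(θ⋆, 0)`. MODELLED (model-2's
tokens): «MV-3 + lossless + MV-P(9e-5 @ slack) + D(∀) + 60-Hz base (ω_s := 377) + V-frozen(LF) +
|E|′(h12)» — structure-preserving classical machines, constant voltage magnitudes frozen at the
printed load flow, frequency-dependent loads with UNPRINTED coefficients `Dᵢ > 0`. VALIDATED: nothing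
here (`c = 29/10` vs Padiyar Table 4.1: successor box, not like-for-like). No sentence of this file
says that the New England system or any grid is stable. Two small `def`s (`PfixQ`, `paramsB`: the
printed-injection data and instance) and the bookkeeping `ℚ`-mirrors (`sQ`, `cQ`, `peQ`) are the
only definitions; no named fact; standard axioms.
-/

noncomputable section

open Set Filter Topology Real Finset
open Summit.Ventures.GridStability.Models
open Summit.Ventures.GridStability.Models.StructurePreserving
open Summit.Ventures.GridStability.Models.NE39SP
open Literature.MathematicalPhysics.PowerSystems

namespace Summit.Ventures.GridStability.Bench.NE39SP

/-! ## Data: the printed injections with the declared slack fix (model-4 routeb-LF.json) -/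

/-- The PRINTED injections of [cite: Padiyar2013, App. D Table D.3] in the node order of
`Models/NE39SP.lean` (buses: `−P_L`, internal nodes: `P_G`), per unit on 100 MVA, with the ONE
declared datum `P_39 := P_G1 − 9/100000 = 1009/200` (slack; token «MV-P(9e-5 @ slack)») so that
`Σ P = 0` exactly (model-4 `sp49/routeb-LF.json` 5658b3fb56a02842, key «P (fixed, Σ = 0)»). -/
def PfixQ : Fin 49 → ℚ :=
  ![-23/250, -276/25, 0, 0, 0, 0,
    0, 0, 0, 0, 0, 0,
    -161/50, -5, 0, 0, -1169/500, -261/50,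
    0, 0, -137/50, 0, -549/200, -1543/500,
    -56/25, -139/100, -281/100, -103/50, -567/200, -157/25,
    0, -3/40, 0, 0, -16/5, -1647/500,
    0, -79/50, 0, 1009/200, 10, 13/2,
    127/25, 158/25, 13/2, 28/5, 27/5, 83/10,
    5/2]

/-- The injections sum to zero exactly (lossless balance with the declared slack). -/
theorem sum_PfixQ : ∑ i, PfixQ i = 0 := by decide +kernel

/-- **Route-(b) instance**: model-2's NE39-SP data `NE39SP.params D` (couplings `b`, inertias,
generator set, damping PARAMETER `D`) with the injections replaced by the printed `PfixQ`.
MODELLED column; same tokens as `NE39SP.params` but «MV-P(9e-5 @ slack)». -/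
def paramsB (D : Fin 49 → ℝ) : Params 49 :=
  { NE39SP.params D with P0 := fun i => (PfixQ i : ℝ) }

/-- Unfolding: couplings of `paramsB D` are model-2's `NE39SP.b`. -/
theorem paramsB_b (D : Fin 49 → ℝ) : (paramsB D).b = NE39SP.b := rfl

/-- Unfolding: injections of `paramsB D`. -/
theorem paramsB_P0 (D : Fin 49 → ℝ) : (paramsB D).P0 = fun i => (PfixQ i : ℝ) := rfl

/-- Unfolding: damping of `paramsB D`. -/
theorem paramsB_D (D : Fin 49 → ℝ) : (paramsB D).D = D := rfl

/-- `Σ P⁰ = 0` for the route-(b) instance. -/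
theorem sum_P0_paramsB (D : Fin 49 → ℝ) : ∑ i, (paramsB D).P0 i = 0 := by
  rw [paramsB_P0]
  have h := sum_PfixQ
  have : (∑ i, (PfixQ i : ℝ)) = ((∑ i, PfixQ i : ℚ) : ℝ) := by push_cast; rfl
  rw [this, h]; simp

/-- `ω₀ = 0` for the route-(b) instance (balanced injections). -/
theorem syncFreq_paramsB (D : Fin 49 → ℝ) : (paramsB D).syncFreq = 0 := by
  unfold Params.syncFreq; rw [sum_P0_paramsB]; simp

/-- `P̄ = P⁰` for the route-(b) instance. -/
theorem Pbar_paramsB (D : Fin 49 → ℝ) (i : Fin 49) : (paramsB D).Pbar i = (PfixQ i : ℝ) := by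
  unfold Params.Pbar; rw [syncFreq_paramsB]; simp [paramsB_P0]

/-- Well-formedness transfers from model-2's instance (same `M`, `gen`, `b`; `D > 0`). -/
theorem wellFormedB {D : Fin 49 → ℝ} (hD : ∀ i, 0 < D i) : (paramsB D).WellFormed where
  M_pos := (NE39SP.wellFormed hD).M_pos
  M_eq_zero := (NE39SP.wellFormed hD).M_eq_zero
  D_pos := hD
  b_symm := NE39SP.b_symm

/-- Connectivity transfers (the coupling graph only reads `b`). -/
theorem preconnectedB (D : Fin 49 → ℝ) : (paramsB D).couplingGraph.Preconnected :=
  NE39SP.preconnected D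

/-- Edge floor transfers: `β ≤ bᵢⱼ` on coupled pairs. -/
theorem edge_lowerB (D : Fin 49 → ℝ) :
    ∀ i j, (paramsB D).couplingGraph.Adj i j → (betaLF : ℝ) ≤ (paramsB D).b i j :=
  NE39SP.edge_lower D

/-! ## (ii) Coercivity from model-4's BFS spanning tree (`Lyapunov/TreePoincare.lean`) -/

/-- The root G1 (idx 39) has depth `0`. -/
theorem depthV_root : depthV 39 = 0 := by decide

/-- BFS tree: the depth drops by exactly one along every parent pointer (49 checks). -/
theorem depthV_parent : ∀ i : Fin 49, i ≠ 39 → depthV (parentV i) + 1 = depthV i := by decide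

/-- `Σ_i depth_i = 338`. -/
theorem sum_depthV : (∑ i, (depthV i : ℝ)) = 338 := by
  have h : ∑ i, depthV i = 338 := by decide +kernel
  have h' := congrArg (Nat.cast : ℕ → ℝ) h
  push_cast at h'
  exact h'

/-- Every tree edge `(j, parent j)` is a listed branch, hence a coupling `≥ β`. -/
theorem beta_le_b_parent (j : Fin 49) (hj : j ≠ 39) :
    (betaLF : ℝ) ≤ NE39SP.b j (parentV j) := by
  have hedge := (by decide : ∀ v : Fin 49, v ≠ 39 →
      (srcV (treeEdge v) = parentV v ∧ tgtV (treeEdge v) = v)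
        ∨ (srcV (treeEdge v) = v ∧ tgtV (treeEdge v) = parentV v)) j hj
  have hne : NE39SP.b j (parentV j) ≠ 0 := by
    unfold NE39SP.b
    refine symmetrize_edgeWeight_ne_zero_of_edge wt_nonneg (treeEdge j) (wt_pos _) ?_
    rcases hedge with h | h
    · exact Or.inr h
    · exact Or.inl h
  unfold NE39SP.b at hne ⊢
  exact le_symmetrize_of_ne_zero wt_nonneg wt_ge_beta hne

/-- The route-(b) window half-width parameter: `τ′ := τ_max + 10⁻⁵` (the `10⁻⁵` buys the `2R`
margin of the existence theorem). -/
def tauB : ℚ := tauLF + 1 / 100000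

/-- `c₀ := cos(2·arctan τ′) = (1 − τ′²)/(1 + τ′²)` as a rational. -/
def c0B : ℚ := (1 - tauB ^ 2) / (1 + tauB ^ 2)

/-- `c₀ = cos γ` with `γ = 2·arctan τ′`. -/
theorem c0B_eq_cos : (c0B : ℝ) = Real.cos (2 * Real.arctan (tauB : ℝ)) := by
  rw [Lyapunov.StructurePreserving.cos_two_mul_arctan]
  unfold c0B; push_cast; ring

/-- `0 ≤ c₀` (indeed `c₀ ≈ 0.919`). -/
theorem c0B_nonneg : (0 : ℝ) ≤ (c0B : ℝ) := by
  exact_mod_cast (show (0 : ℚ) ≤ c0B by unfold c0B tauB tauLF; norm_num)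

/-- The coercivity constant `μ := c₀ β / (2 Σ depth) = c₀ β / 676`. -/
def muB : ℚ := c0B * betaLF / 676

/-- **Hypothesis (ii) of the existence theorem, discharged by the tree Poincaré inequality**:
`μ Σ vᵢ² ≤ c₀ · ½ΣΣ bᵢⱼ (vᵢ − vⱼ)²` for every `v` with `v 39 = 0`. No matrix certificate. -/
theorem coerciveB (v : Fin 49 → ℝ) (hv : v 39 = 0) :
    (muB : ℝ) * ∑ i, v i ^ 2 ≤ (c0B : ℝ) * (1 / 2 * ∑ i, ∑ j, NE39SP.b i j * (v i - v j) ^ 2) := by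
  have h := Lyapunov.TreePoincare.coercivity_of_spanningTree parentV depthV 39 NE39SP.b
    NE39SP.b_nonneg depthV_root depthV_parent beta_pos beta_le_b_parent c0B_nonneg
    (by rw [sum_depthV]; norm_num) v hv
  rw [sum_depthV] at h
  have hμ : (muB : ℝ) = (c0B : ℝ) * (betaLF : ℝ) / (2 * 338) := by unfold muB; push_cast; ring
  rw [hμ]
  exact h

/-! ## (i) The margin: `|δ₀ᵢ − δ₀ⱼ| + 2R ≤ γ = 2·arctan τ′` -/

/-- The enclosure radius `R := 2·10⁻⁶`. -/
def RB : ℚ := 1 / 500000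

/-- `u/(1 + u²) ≤ arctan u` for `u ≥ 0` (`sin y cos y ≤ sin y ≤ y` at `y = arctan u`). [folklore] -/
theorem div_one_add_sq_le_arctan {u : ℝ} (hu : 0 ≤ u) : u / (1 + u ^ 2) ≤ Real.arctan u := by
  have hy0 : 0 ≤ Real.arctan u := by
    have := Real.arctan_strictMono.monotone hu
    rwa [Real.arctan_zero] at this
  have hpos : 0 < 1 + u ^ 2 := by positivity
  have hsc : Real.sin (Real.arctan u) * Real.cos (Real.arctan u) = u / (1 + u ^ 2) := by
    rw [Real.sin_arctan, Real.cos_arctan]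
    have hs : Real.sqrt (1 + u ^ 2) * Real.sqrt (1 + u ^ 2) = 1 + u ^ 2 :=
      Real.mul_self_sqrt hpos.le
    rw [show u / Real.sqrt (1 + u ^ 2) * (1 / Real.sqrt (1 + u ^ 2))
        = u / (Real.sqrt (1 + u ^ 2) * Real.sqrt (1 + u ^ 2)) by ring, hs]
  have hsin0 : 0 ≤ Real.sin (Real.arctan u) := by
    rw [Real.sin_arctan]; positivity
  have hcos1 : Real.cos (Real.arctan u) ≤ 1 := Real.cos_le_one _
  have h1 : Real.sin (Real.arctan u) * Real.cos (Real.arctan u) ≤ Real.sin (Real.arctan u) := by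
    nlinarith
  have h2 : Real.sin (Real.arctan u) ≤ Real.arctan u := Real.sin_le hy0
  rw [← hsc]
  exact h1.trans h2

/-- `2R ≤ 2·arctan τ′ − 2·arctan τ_max`: the `10⁻⁵` added to `τ_max` covers twice the enclosure
radius (`arctan τ′ − arctan τ = arctan u`, `u = (τ′ − τ)/(1 + τ′τ) ≈ 9.6·10⁻⁶ ≥ u/(1+u²) ≥ R`). -/
theorem two_R_le_gap :
    2 * (RB : ℝ) ≤ 2 * Real.arctan (tauB : ℝ) - 2 * Real.arctan (tauLF : ℝ) := by
  have hab : (-1 : ℝ) < (tauB : ℝ) * (tauLF : ℝ) := by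
    exact_mod_cast (show (-1 : ℚ) < tauB * tauLF by unfold tauB tauLF; norm_num)
  rw [two_mul_arctan_sub hab]
  set u : ℝ := ((tauB : ℝ) - (tauLF : ℝ)) / (1 + (tauB : ℝ) * (tauLF : ℝ)) with hu
  have huq : u = (((tauB - tauLF) / (1 + tauB * tauLF) : ℚ) : ℝ) := by rw [hu]; push_cast; ring
  have hu0 : 0 ≤ u := by
    rw [huq]; exact_mod_cast (show (0 : ℚ) ≤ (tauB - tauLF) / (1 + tauB * tauLF) by
      unfold tauB tauLF; norm_num)
  have hlb := div_one_add_sq_le_arctan hu0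
  have hR : (RB : ℝ) ≤ u / (1 + u ^ 2) := by
    rw [huq]
    have hq : RB ≤ ((tauB - tauLF) / (1 + tauB * tauLF))
        / (1 + ((tauB - tauLF) / (1 + tauB * tauLF)) ^ 2) := by
      unfold RB tauB tauLF; norm_num
    have := (Rat.cast_le (K := ℝ)).2 hq
    push_cast at this ⊢
    exact this
  linarith

/-- **Hypothesis (i) of the existence theorem**: on every coupled pair,
`|δ₀ᵢ − δ₀ⱼ| + 2R ≤ 2·arctan τ′` (model-2's window `≤ 2·arctan τ_max` plus `two_R_le_gap`). -/
theorem marginB (i j : Fin 49) (hb : 0 < NE39SP.b i j) :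
    |NE39SP.δ₀ i - NE39SP.δ₀ j| + 2 * (RB : ℝ) ≤ 2 * Real.arctan (tauB : ℝ) := by
  have hw := NE39SP.window (fun _ => 1) i j (by rw [params_b]; exact hb.ne')
  unfold NE39SP.θ at hw
  linarith [two_R_le_gap]

/-! ## The certified level below `c⋆(γ, β)` -/

/-- `0 ≤ τ′ < 1`, so `0 ≤ γ < π/2`. -/
theorem tauB_bounds : (0 : ℝ) ≤ (tauB : ℝ) ∧ (tauB : ℝ) < 1 := by
  constructor
  · exact_mod_cast (show (0 : ℚ) ≤ tauB by unfold tauB tauLF; norm_num)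
  · exact_mod_cast (show tauB < 1 by unfold tauB tauLF; norm_num)

/-- **Kernel inequality `29/10 < c⋆(2·arctan τ′, β)`** (π-bound of
`Lyapunov/StructurePreservingLevelBound.lean`; the rational bound is `≈ 2.92106`). -/
theorem level_lt_levelBound_routeB :
    (29 / 10 : ℝ) < Lyapunov.StructurePreserving.levelBound (2 * Real.arctan (tauB : ℝ))
      (betaLF : ℝ) := by
  have h := Lyapunov.StructurePreserving.levelBound_two_mul_arctan_ge_pi tauB_bounds.1
    tauB_bounds.2 beta_pos.le
  have hq : (29 / 10 : ℚ) < betaLF * ((1 - tauB) ^ 2 / (1 + tauB ^ 2))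
      * (1570796 / 1000000 - 2 * tauB) / 4 := by
    unfold tauB tauLF betaLF; norm_num
  have hr : (29 / 10 : ℝ) < (betaLF : ℝ) * ((1 - (tauB : ℝ)) ^ 2 / (1 + (tauB : ℝ) ^ 2))
      * (1570796 / 1000000 - 2 * (tauB : ℝ)) / 4 := by
    have h' := (Rat.cast_lt (K := ℝ)).2 hq
    push_cast at h'
    exact h'
  exact hr.trans_le h

/-! ## (iii) The residuals at `δ₀`, exactly -/

/-- **Edge re-indexing**: for couplings read off an indexed edge list,
`Σ_j (w_{ij} + w_{ji}) f_j = Σ_e wt_e ([src e = i] f_{tgt e} + [tgt e = i] f_{src e})` — a node's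
coupling sum runs over its incident listed edges only. [folklore] -/
theorem sum_symmetrize_edgeWeight_mul {m k : ℕ} (src tgt : Fin m → Fin k) (wt : Fin m → ℝ)
    (f : Fin k → ℝ) (i : Fin k) :
    ∑ j, symmetrize (edgeWeight src tgt wt) i j * f j
      = ∑ e, wt e * ((if src e = i then f (tgt e) else 0) + (if tgt e = i then f (src e) else 0)) := by
  have h1 : ∑ j, edgeWeight src tgt wt i j * f j = ∑ e, wt e * (if src e = i then f (tgt e) else 0) := by
    unfold edgeWeight
    simp_rw [Finset.sum_mul]
    rw [Finset.sum_comm]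
    refine Finset.sum_congr rfl fun e _ => ?_
    by_cases hs : src e = i
    · simp only [hs, true_and, ite_mul, zero_mul, if_true]
      rw [Finset.sum_ite_eq]; simp
    · simp [hs]
  have h2 : ∑ j, edgeWeight src tgt wt j i * f j = ∑ e, wt e * (if tgt e = i then f (src e) else 0) := by
    unfold edgeWeight
    simp_rw [Finset.sum_mul]
    rw [Finset.sum_comm]
    refine Finset.sum_congr rfl fun e _ => ?_
    by_cases ht : tgt e = i
    · simp only [ht, and_true, ite_mul, zero_mul, if_true]
      rw [Finset.sum_ite_eq]; simp
    · simp [ht]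
  unfold symmetrize
  simp_rw [add_mul, Finset.sum_add_distrib, h1, h2, ← Finset.sum_add_distrib, ← mul_add]

/-- Rational sine of a half-angle: `2x/(1 + x²)`. -/
def sQ (x : ℚ) : ℚ := 2 * x / (1 + x ^ 2)

/-- Rational cosine of a half-angle: `(1 − x²)/(1 + x²)`. -/
def cQ (x : ℚ) : ℚ := (1 - x ^ 2) / (1 + x ^ 2)

/-- `sin(2·arctan a − 2·arctan b)` as a rational function of `a`, `b`. -/
def gQ (a b : ℚ) : ℚ := sQ a * cQ b - cQ a * sQ b

/-- **Rational mirror of the injections at `δ₀`**: `fᵢ(δ₀)` summed over the incident listed edges,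
all in `ℚ` (computable; evaluated by the kernel in `residualB`). -/
def peQ (i : Fin 49) : ℚ :=
  ∑ e : Fin 56, wtLFQ e * ((if srcV e = i then gQ (tLFQ i) (tLFQ (tgtV e)) else 0)
    + (if tgtV e = i then gQ (tLFQ i) (tLFQ (srcV e)) else 0))

/-- The sine of a branch angle at the half-angle point is the rational `gQ`. -/
theorem sin_δ₀_sub (i j : Fin 49) :
    Real.sin (NE39SP.δ₀ i - NE39SP.δ₀ j) = ((gQ (tLFQ i) (tLFQ j) : ℚ) : ℝ) := by
  unfold NE39SP.δ₀
  rw [Real.sin_sub, sin_halfAngle, cos_halfAngle, sin_halfAngle, cos_halfAngle]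
  unfold halfSin halfCos NE39SP.t gQ sQ cQ
  push_cast
  ring

/-- **The injections at `δ₀` are the rationals `peQ`** (exact; `fᵢ(δ₀) = Σⱼ bᵢⱼ sin(δ₀ᵢ − δ₀ⱼ)`). -/
theorem pe_δ₀_eq_cast (i : Fin 49) :
    ∑ j, NE39SP.b i j * Real.sin (NE39SP.δ₀ i - NE39SP.δ₀ j) = ((peQ i : ℚ) : ℝ) := by
  simp_rw [sin_δ₀_sub]
  unfold NE39SP.b NE39SP.wt
  rw [sum_symmetrize_edgeWeight_mul]
  unfold peQ
  push_cast
  refine Finset.sum_congr rfl fun e _ => ?_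
  by_cases h1 : srcV e = i <;> by_cases h2 : tgtV e = i <;> simp [h1, h2]

/-- The rational residual inequality of route (b): `4 Σ_{i ≠ 39} (Pᵢ − fᵢ(δ₀))² < μ²R²`
(`≈ 3.08·10⁻¹⁶ < 2.05·10⁻¹⁵`), ONE kernel evaluation over `ℚ`. CERTIFIED column. -/
theorem residualQ :
    4 * ∑ i ∈ Finset.univ.erase (39 : Fin 49), (PfixQ i - peQ i) ^ 2 < muB ^ 2 * RB ^ 2 := by
  decide +kernel

/-- **Hypothesis (iii) of the existence theorem** (real form, by `pe_δ₀_eq_cast` + `residualQ`). -/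
theorem residualB :
    4 * ∑ i ∈ Finset.univ.erase (39 : Fin 49),
        ((PfixQ i : ℝ) - ∑ j, NE39SP.b i j * Real.sin (NE39SP.δ₀ i - NE39SP.δ₀ j)) ^ 2
      < (muB : ℝ) ^ 2 * (RB : ℝ) ^ 2 := by
  simp_rw [pe_δ₀_eq_cast]
  have h := (Rat.cast_lt (K := ℝ)).2 residualQ
  push_cast at h
  exact h

end Summit.Ventures.GridStability.Bench.NE39SP

end
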